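import Literature.Probability.LatticeModels.LatticeLaplacian
import Mathlib.Combinatorics.SimpleGraph.Connectivity.Connected
import HarnessLib

/-!
# Chelkak–Wan: the uniform discrete boundary Harnack principle on simply connected subsets of `ℤ²`

Topic `Literature/Probability/LatticeModels`; companion of `LatticeLaplacian.lean`
(`IsLatticeHarmonicOn`, `latticeOuterBoundary`) and `WeakBeurlingEstimate.lean`. ONE NAMED FACT
(statement only, nothing asserted) from D. Chelkak, Y. Wan, *On the convergence of massive
loop-erased random walks to massive SLE(2) curves*, Electron. J. Probab. 26 (2021), paper 54,
arXiv:1903.08045 (`ChelkakWan2021`), §3.2 "Boundary behavior of discrete harmonic functions":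

* `ChelkakWan_uniformBoundaryHarnack` — Corollary 3.8 (iterating Lemma 3.7): there is a universal
  `k < 1` such that for every simply connected discrete domain `Ω^δ ⊂ δℤ²`, base point `o`,
  boundary vertex `b` and radius `r` with `o ∉ B_{Ω̂^δ}(b, r)`, and every pair of positive discrete
  harmonic functions `H₁, H₂` on `Ω^δ` with Dirichlet boundary conditions on
  `∂Ω^δ ∖ ∂Ω^δ_o(b, r)`, `max_{u,v ∈ Ω^δ ∖ Ω^δ_o(b, 2^{-q} r)} (H₁(u)/H₂(u))/(H₁(v)/H₂(v)) ≤ (1+k^q)/(1−k^q)`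
  — the ratio of two positive harmonic functions vanishing on the boundary near `b` is continuous
  at the prime end `b`, UNIFORMLY over all shapes of the discrete domain (no smoothness, fjords and
  bottlenecks of a few lattice steps allowed). The proof (ibid.) rests on D. Chelkak, *Robust
  discrete complex analysis: a toolbox*, Ann. Probab. 44 (2016) (`Chelkak2016`): factorisation of
  random-walk partition functions through discrete cross-ratios and their uniform comparison with
  discrete and continuous extremal lengths (Thm. 7.1, Prop. 6.2, Cor. 6.3).

Dictionary (paper ↔ tree), mesh `δ = 1` (the statement is scale invariant):
* "discrete domain `Ω^δ`" (ibid. §2.1: a subgraph of `δℤ²` given by its vertex set `Int Ω^δ`, all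
  lattice edges between interior vertices, boundary `∂Ω^δ` = half-edges `(v; (v_int, v))` with
  `v ∉ Int Ω^δ ∼ v_int ∈ Int Ω^δ`; the walk is killed when it steps on a vertex outside `Int Ω^δ`)
  = a finite `S ⊆ ℤ²` (`= Int Ω^δ`) with its outer vertex boundary `latticeOuterBoundary S`;
  "simply connected" (the polygonal representation `Ω̂^δ` — union of the open `2δ × 2δ` squares
  centred at the vertices — is simply connected) = the graphs induced by `zdGraph 2` on `S` and on
  `Sᶜ` are connected (the tree's reading of "simply connected subset of `ℤ²`", as in
  `ExcursionPoissonKernelAsymptotics.lean`);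
* "positive discrete harmonic `H : Ω^δ → ℝ₊`" = `IsLatticeHarmonicOn H S` (`Δ H = 0` on `S`, the
  values of `H` on `latticeOuterBoundary S` being the boundary data), `H > 0` on `S`, `H ≥ 0` on
  the outer boundary; a function on sites carries ONE value per boundary vertex (the paper allows
  one per half-edge) — a special case;
* `Ω^δ_o(b, r)` = the connected component of `Ω^δ ∖ B(b, r)` containing `o`; the Dirichlet
  condition "`H = 0` on `∂Ω^δ ∖ ∂Ω^δ_o(b, r)`" is IMPLIED by: `H(w) = 0` at every outer-boundary
  vertex `w` unless each interior neighbour of `w` is joined to `o` by a lattice path in `S` staying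
  at distance `≥ r + 1` from `b` (then every half-edge at `w` issues from `Ω^δ_o(b, r)`);
* the set `Ω^δ ∖ Ω^δ_o(b, ρ)`, `ρ = 2^{-q} r`, CONTAINS every interior vertex joined to an interior
  neighbour of `b` by a lattice path in `S` whose vertices are at distance `< ρ − 1` from `b` (such a
  vertex is joined to `b` inside `Ω̂^δ ∩ B(b, ρ)`, i.e. lies in the inner ball `B_{Ω̂^δ}(b, ρ)`, which
  by definition misses `Ω^δ_o(b, ρ)`); Euclidean distances are those of `Site.toComplex`.
So the `Prop` below is the printed corollary restricted to vertex-supported boundary data, to base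
points `o ∈ Int Ω^δ` with `|o − b| ≥ r`, and to points of the inner ball; by the bullets above it
FOLLOWS from the printed statement. `-- TODO(general form):` boundary data per half-edge, general
`o ∈ Ω̂^δ ∖ B_{Ω̂^δ}(b,r)`, the full set `Ω^δ ∖ Ω^δ_o(b, 2^{-q}r)` (pockets hanging off the inner ball),
Lemma 3.7 itself (one-step contraction by `k` from the arc `S_o(b, r⁺)`), and general isoradial /
properly embedded graphs (Chelkak 2016) are not transcribed.

NOT covered by print (recorded for the consumers): (1) Chelkak's general discrete domains
`(V^Ω, E^Ω_int)` in which a lattice edge between two interior vertices may be absent — the walk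
killed on EDGES, as for the tree's `discreteDomainGraph Ω δ` (edges = lattice edges whose closed
segment lies in `closure Ω`): Chelkak 2016, §2.2 "one can easily remove this assumption" is a
remark, the theorems are proved for induced domains; (2) Euclidean balls around a boundary point
of the CONTINUUM domain in place of the inner ball `B_{Ω̂^δ}(b, ρ)`.

Why here: the line `symplectic-fermion-anchor` of crux `SAWLoopFugacityFlow.AvoidanceLimit`
(stmt-CriticalPhenomena-10649) reduces its stub `stub_ratioOscillation` to a uniform BHP for the
edge-killed `Ω_δ`-walk at the two marked prime ends of a Jordan domain
(`Theorems/SAWLoopFugacityFlowAvoidanceLimitRatioOscillationReduction.lean`); this file records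
exactly what print provides toward it. Statement transcribed from the held text
(`lit read arxiv:1903.08045`, §2.1, §3.2) by the line lead's stub worker; NOT proved here.
-/

noncomputable section

namespace Literature.Probability.LatticeModels

/-- **Chelkak–Wan 2021, Corollary 3.8 (uniform discrete boundary Harnack principle), vertex form on
`ℤ²`.** There is a universal `k ∈ (0, 1)` such that: for every finite `S ⊆ ℤ²` with `S` and
`ℤ² ∖ S` nearest-neighbour connected (a simply connected discrete domain `Int Ω = S`), every
outer-boundary vertex `b` of `S`, every radius `r > 0` and base vertex `o ∈ S` with `|o − b| ≥ r`,
and every two functions `H₁, H₂` lattice harmonic on `S`, positive on `S`, nonnegative on the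
outer boundary, and vanishing at each outer-boundary vertex `w` unless all interior neighbours of
`w` are joined to `o` by lattice paths in `S` at distance `≥ r + 1` from `b` (Dirichlet conditions
on `∂Ω ∖ ∂Ω_o(b, r)`), one has, for every `q ≥ 1` and all `u, v` joined to interior neighbours of `b`
by lattice paths in `S` at distance `< 2^{-q} r − 1` from `b` (points of the inner ball
`B_{Ω̂}(b, 2^{-q} r) ⊆ Ω ∖ Ω_o(b, 2^{-q} r)`):
`(H₁(u)/H₂(u)) / (H₁(v)/H₂(v)) ≤ (1 + k^q)/(1 − k^q)`.
[cite: ChelkakWan2021, Corollary 3.8 (§3.2)] -/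
def ChelkakWan_uniformBoundaryHarnack : Prop :=
  ∃ k : ℝ, 0 < k ∧ k < 1 ∧ ∀ (S : Set (Site 2)), S.Finite →
    ((zdGraph 2).induce S).Connected → ((zdGraph 2).induce Sᶜ).Connected →
    ∀ (b : Site 2), b ∈ latticeOuterBoundary S → ∀ (r : ℝ), 0 < r →
    ∀ (o : Site 2), o ∈ S → r ≤ dist (Site.toComplex o) (Site.toComplex b) →
    ∀ (H₁ H₂ : Site 2 → ℝ), IsLatticeHarmonicOn H₁ S → IsLatticeHarmonicOn H₂ S →
      (∀ x ∈ S, 0 < H₁ x) → (∀ x ∈ S, 0 < H₂ x) →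
      (∀ w ∈ latticeOuterBoundary S, 0 ≤ H₁ w) → (∀ w ∈ latticeOuterBoundary S, 0 ≤ H₂ w) →
      (∀ w ∈ latticeOuterBoundary S, (H₁ w ≠ 0 ∨ H₂ w ≠ 0) → ∀ s ∈ S, (zdGraph 2).Adj s w →
        ∃ p : (zdGraph 2).Walk s o, ∀ x ∈ p.support,
          x ∈ S ∧ r + 1 ≤ dist (Site.toComplex x) (Site.toComplex b)) →
      ∀ (q : ℕ), 1 ≤ q → ∀ (u v : Site 2),
        (∃ (u' : Site 2) (p : (zdGraph 2).Walk u u'), (zdGraph 2).Adj u' b ∧ ∀ x ∈ p.support,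
          x ∈ S ∧ dist (Site.toComplex x) (Site.toComplex b) + 1 < (2 : ℝ)⁻¹ ^ q * r) →
        (∃ (v' : Site 2) (p : (zdGraph 2).Walk v v'), (zdGraph 2).Adj v' b ∧ ∀ x ∈ p.support,
          x ∈ S ∧ dist (Site.toComplex x) (Site.toComplex b) + 1 < (2 : ℝ)⁻¹ ^ q * r) →
        H₁ u / H₂ u / (H₁ v / H₂ v) ≤ (1 + k ^ q) / (1 - k ^ q)

end Literature.Probability.LatticeModels

end
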